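import Summits.HubbardSuperconductivity.HubbardSuperconductivity.Theses.AbsenceCertificate
import Literature.MathematicalPhysics.QuantumLattice.DWaveOnePointCertificate
import Literature.MathematicalPhysics.QuantumLattice.DWaveSourceProofs
import Literature.MathematicalPhysics.QuantumLattice.FockRelabel
import Literature.MathematicalPhysics.QuantumLattice.FinDimSpectrumProofs
import Literature.Probability.LatticeModels.TwoPointLogConvex

/-!
# Route `AbsenceCertificate` — support item `OnePointSoundness` (stmt-HubbardSuperconductivity-9685)

SOUNDNESS of one-point SOS certificates (layer 2 of `StripeSourceCeiling`): a
`DWaveOnePointCertificate R U μ h η` gives `dWaveSourceDensity L U μ h ≤ η` for all `L ≥ L₀`.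

Proof. Apply the tracial ground-state functional `ω₀ = groundStateFunctional (H_L)`,
`H_L = dWaveSourceTorus L U μ h`, to the certificate identity
`η·1 - (P₀ + P₀†)/2 = Σ_j s_j† s_j + Σ_k a_k† (H a_k - a_k H) + Σ_m (H b_m - b_m H) + Σ_i (τ_{x_i}B_i - B_i)`
and take real parts:
* `ω₀(1) = 1`, `Re ω₀(P₀†) = Re ω₀(P₀)` (`groundStateFunctional_one`, `…_conjTranspose_re`);
* `ω₀(s† s) ≥ 0` (`groundStateFunctional_nonneg`);
* `ω₀(a† (H a - a H)) = ω₀(a† (H - E₀) a) ≥ 0` (`groundStateFunctional_mul_hamiltonian`,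
  `posSemidef_sub_groundEnergy`, `groundStateFunctional_nonneg_of_posSemidef`);
* `ω₀(H b - b H) = E₀ ω₀(b) - E₀ ω₀(b) = 0`;
* `ω₀(τ_x B - B) = 0`: a torus translation of a placed box polynomial is implemented by the
  second-quantised site permutation `fockTranslate` (`relabel (Orb.translate v)`, with the fermionic
  signs — `toMatrix_translate`, by induction over the free algebra), which commutes with the
  translation-invariant `H_L` (`relabel_translate_dWaveSourceTorus`), and `ω₀` is invariant under
  unitaries commuting with `H_L` (`groundStateFunctional_conj_of_commute`).
Hence `Re ω₀(P₀) ≤ η`, and `dWaveSourceDensity = Re ω₀(Δ_d)/L² = Re ω₀(P₀)` by the same invariance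
(`Δ_d = Σ_x P_x`, `P_x = τ_x P₀`).

Lean note: the concrete torus carries two `DecidableEq` instance paths (via the `Lex` linear order
and via the product/function instances), so identity matrices coming from the generic `FockRelabel`
lemmas are moved to this file's path entrywise (`Matrix.one_apply`, `split_ifs`).

Sources: M. Araújo et al. (2023) §3.2 (state-optimality conditions) and §6.1; J. Wang et al. (2024);
H. Tasaki, *Physics and Mathematics of Quantum Many-Body Systems* (2020), App. A;
O. Bratteli, D. W. Robinson II, §5.2.2 (implemented site permutations). No new definitions.
-/

-- the mandated namespace `Summit.<Summit>.<Problem>.Theorems` repeats `HubbardSuperconductivity`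
-- (single-problem summit, D-0017), which the `dupNamespace` linter flags on every declaration
set_option linter.dupNamespace false

noncomputable section

namespace Summit.HubbardSuperconductivity.HubbardSuperconductivity.Theorems.AbsenceCertificate

open Matrix Literature.MathematicalPhysics.QuantumLattice Literature.Probability.LatticeModels
open scoped ComplexOrder

/-! ### Real parts of a linear functional over list sums -/

section ListSums

variable {M : Type*} [AddCommMonoid M] [Module ℂ M]

/-- A functional with non-negative real part on every summand has non-negative real part on the
list sum. [folklore] -/
theorem re_map_list_sum_nonneg {X : Type*} (ω : M →ₗ[ℂ] ℂ) (l : List X) (f : X → M)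
    (h : ∀ x ∈ l, 0 ≤ (ω (f x)).re) : 0 ≤ (ω (l.map f).sum).re := by
  induction l with
  | nil => simp
  | cons a l ih =>
      rw [List.map_cons, List.sum_cons, map_add, Complex.add_re]
      exact add_nonneg (h a (by simp)) (ih fun x hx => h x (by simp [hx]))

/-- A functional vanishing on every summand vanishes (in real part) on the list sum. [folklore] -/
theorem re_map_list_sum_eq_zero {X : Type*} (ω : M →ₗ[ℂ] ℂ) (l : List X) (f : X → M)
    (h : ∀ x ∈ l, (ω (f x)).re = 0) : (ω (l.map f).sum).re = 0 := by
  induction l with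
  | nil => simp
  | cons a l ih =>
      rw [List.map_cons, List.sum_cons, map_add, Complex.add_re, h a (by simp),
        ih fun x hx => h x (by simp [hx]), add_zero]

end ListSums

/-! ### Torus translations of placed box polynomials -/

section Translate

variable {L : ℕ} [NeZero L] {R : ℕ}

/-- **Translations of placed box polynomials are implemented by the site-permutation unitaries**:
`(τ_x q).toMatrix L = T_x (q.toMatrix L) T_x⁻¹` with `T_x = fockTranslate (x mod L)` (as the
Bogoliubov automorphism `relabel (Orb.translate (x mod L))`), for every placed box polynomial `q`
(induction over the free algebra: letters by `relabel_translate_creation/annihilation`).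
Bratteli–Robinson II, §5.2.2, Thm. 5.2.5. [folklore] -/
theorem toMatrix_translate (q : PlacedBoxPoly R) (x : Site 2) :
    (q.translate x).toMatrix L = relabel (Orb.translate (Torus.proj L x)) (q.toMatrix L) := by
  obtain ⟨y, p⟩ := q
  change PlacedBoxPoly.toMatrix L ⟨y + x, p⟩ = relabel _ (PlacedBoxPoly.toMatrix L ⟨y, p⟩)
  induction p using FreeAlgebra.induction with
  | grade0 c =>
      rw [PlacedBoxPoly.toMatrix_algebraMap, PlacedBoxPoly.toMatrix_algebraMap,
        relabel_eq_fockRelabel_conj, fockRelabel_val, Matrix.mul_smul, Matrix.mul_one,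
        Matrix.smul_mul, fockRelabel_mul_conjTranspose]
      -- the two identity matrices carry the two `DecidableEq` instance paths of the concrete torus
      congr 1
      ext i j
      simp only [Matrix.one_apply]
      split_ifs <;> rfl
  | grade1 a =>
      rw [PlacedBoxPoly.toMatrix_ι, PlacedBoxPoly.toMatrix_ι]
      unfold PlacedBoxPoly.letterMatrix
      have hp : Torus.proj L (y + x + a.offset) = Torus.proj L (y + a.offset) + Torus.proj L x := by
        rw [add_right_comm, Torus.proj_add]
      split_ifs
      · rw [relabel_translate_creation, hp]
      · rw [relabel_translate_annihilation, hp]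
  | mul a b ha hb =>
      rw [PlacedBoxPoly.toMatrix_mul, PlacedBoxPoly.toMatrix_mul, relabel_mul, ha, hb]
  | add a b ha hb =>
      rw [PlacedBoxPoly.toMatrix_add, PlacedBoxPoly.toMatrix_add, relabel_add, ha, hb]

/-- **The sourced Hubbard Hamiltonian is translation invariant**:
`T_v (H - μN - h(Δ_d + Δ_d†)) T_v⁻¹ = H - μN - h(Δ_d + Δ_d†)`. [folklore] -/
theorem relabel_translate_dWaveSourceTorus (v : TorusSite 2 L) (U μ h : ℝ) :
    relabel (Orb.translate v) (dWaveSourceTorus L U μ h) = dWaveSourceTorus L U μ h := by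
  rw [dWaveSourceTorus_eq, relabel_sub, relabel_smul, relabel_add, relabel_conjTranspose,
    relabel_translate_hubbardTorusWith, relabel_translate_pairField]

/-- **The tracial ground state of the sourced Hamiltonian is translation invariant**:
`ω₀(T_v O T_v⁻¹) = ω₀(O)`. Tasaki (2020), App. A. [folklore] -/
theorem groundStateFunctional_relabel_translate (v : TorusSite 2 L) (U μ h : ℝ)
    (O : Matrix (Finset (Orb (FermionTorus 2 L))) (Finset (Orb (FermionTorus 2 L))) ℂ) :
    (dWaveSourceTorus L U μ h).groundStateFunctional (relabel (Orb.translate v) O) =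
      (dWaveSourceTorus L U μ h).groundStateFunctional O := by
  have hH : (dWaveSourceTorus L U μ h).IsHermitian :=
    dWaveSourceTorus_isHermitian L (isHermitian_hubbardTorusWith L 1 U μ) h
  -- `Uᴴ U = 1`, moved to the `DecidableEq` instance path of this context
  have hUU : ((fockRelabel (Orb.translate v)).val)ᴴ * (fockRelabel (Orb.translate v)).val = 1 := by
    rw [fockRelabel_val, fockRelabel_conjTranspose_mul_self]
    ext i j
    simp only [Matrix.one_apply]
    split_ifs <;> rfl
  rw [relabel_eq_fockRelabel_conj]
  exact groundStateFunctional_conj_of_commute hH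
    (fockRelabel_commute_of_relabel_eq _ (relabel_translate_dWaveSourceTorus v U μ h)) hUU O

/-- The sourced `d`-wave density is the real part of the one-point function of the local pair at the
origin: `dWaveSourceDensity L U μ h = Re ω₀(P₀)` (`Δ_d = Σ_x P_x`, `P_x = τ_x P₀`, translation
invariance of `ω₀`). [folklore] -/
theorem dWaveSourceDensity_eq_re_localPair (U μ h : ℝ) :
    dWaveSourceDensity L U μ h =
      ((dWaveSourceTorus L U μ h).groundStateFunctional (localPair dWaveFormFactor L 0)).re := by
  have hL : (L : ℝ) ≠ 0 := by exact_mod_cast NeZero.ne L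
  have hx : ∀ x : TorusSite 2 L,
      (dWaveSourceTorus L U μ h).groundStateFunctional (localPair dWaveFormFactor L x) =
        (dWaveSourceTorus L U μ h).groundStateFunctional (localPair dWaveFormFactor L 0) := by
    intro x
    rw [← groundStateFunctional_relabel_translate x U μ h (localPair dWaveFormFactor L 0),
      relabel_translate_localPair, zero_add]
  rw [dWaveSourceDensity, pairField, map_sum, Finset.sum_congr rfl fun x _ => hx x, Finset.sum_const,
    Finset.card_univ, Fintype.card_fun, ZMod.card, Fintype.card_fin, nsmul_eq_mul, Complex.mul_re]
  simp only [Complex.natCast_re, Complex.natCast_im, zero_mul, sub_zero]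
  push_cast
  field_simp

end Translate

/-! ### The functional on the certificate terms -/

section Terms

variable {n : Type*} [Fintype n] [DecidableEq n]

/-- **KKT (state-optimality) terms are non-negative**: `Re ω₀(a†(Ha - aH)) ≥ 0` for Hermitian `H`
(`ω₀(a† a H) = E₀ ω₀(a† a)`, so the value is `ω₀(a†(H - E₀)a) ≥ 0`).
Araújo et al. (2023) §3.2. [folklore] -/
theorem re_groundStateFunctional_kkt_nonneg {H : Matrix n n ℂ} (hH : H.IsHermitian)
    (a : Matrix n n ℂ) :
    0 ≤ (H.groundStateFunctional (aᴴ * (H * a - a * H))).re := by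
  have hps : (aᴴ * (H - algebraMap ℝ (Matrix n n ℂ) H.groundEnergy) * a).PosSemidef :=
    (posSemidef_sub_groundEnergy hH).conjTranspose_mul_mul_same a
  have h0 := groundStateFunctional_nonneg_of_posSemidef H hps
  have heq : H.groundStateFunctional (aᴴ * (H * a - a * H)) =
      H.groundStateFunctional (aᴴ * (H - algebraMap ℝ (Matrix n n ℂ) H.groundEnergy) * a) := by
    rw [Matrix.mul_sub, ← Matrix.mul_assoc, ← Matrix.mul_assoc, map_sub,
      groundStateFunctional_mul_hamiltonian, Algebra.algebraMap_eq_smul_one, Matrix.mul_sub,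
      Matrix.sub_mul, Matrix.mul_smul, Matrix.mul_one, Matrix.smul_mul, map_sub,
      LinearMap.map_smul_of_tower, Complex.real_smul]
  rw [heq]
  exact (Complex.nonneg_iff.mp h0).1

/-- **Stationarity terms vanish**: `ω₀(Hb - bH) = 0` for Hermitian `H`. [folklore] -/
theorem groundStateFunctional_stat_eq_zero {H : Matrix n n ℂ} (hH : H.IsHermitian)
    (b : Matrix n n ℂ) : H.groundStateFunctional (H * b - b * H) = 0 := by
  rw [map_sub, groundStateFunctional_hamiltonian_mul hH, groundStateFunctional_mul_hamiltonian,
    sub_self]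

/-- **SOS terms are non-negative**: `Re ω₀(s† s) ≥ 0`. [folklore] -/
theorem re_groundStateFunctional_sos_nonneg (H s : Matrix n n ℂ) :
    0 ≤ (H.groundStateFunctional (sᴴ * s)).re :=
  (Complex.nonneg_iff.mp (groundStateFunctional_nonneg H s)).1

end Terms

/-! ### The item -/

/-- **Soundness of one-point certificates** (core of stmt-HubbardSuperconductivity-9685): a one-point
SOS certificate `DWaveOnePointCertificate R U μ h η` certifies `dWaveSourceDensity L U μ h ≤ η` for
every `L ≥ L₀` (the certificate's threshold). Evaluate the certificate identity in the tracial ground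
state of `dWaveSourceTorus L U μ h`: the SOS and KKT terms are non-negative, the stationarity and
translation-coboundary terms vanish, the left side is `η - Re ω₀(P₀) = η - dWaveSourceDensity`.
[cite: AraujoEtAl2023, §3.2 and §6.1] -/
theorem onePointSoundness_core (R : ℕ) (U μ h η : ℝ)
    (hc : Nonempty (DWaveOnePointCertificate R U μ h η)) :
    ∃ L₀ : ℕ, ∀ (L : ℕ) [NeZero L], L₀ ≤ L → dWaveSourceDensity L U μ h ≤ η := by
  obtain ⟨cert⟩ := hc
  refine ⟨cert.L₀, fun L _ hL => ?_⟩
  set H := dWaveSourceTorus L U μ h with hHdef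
  have hH : H.IsHermitian := dWaveSourceTorus_isHermitian L (isHermitian_hubbardTorusWith L 1 U μ) h
  set ω := H.groundStateFunctional with hω
  have hid := cert.identity L hL
  -- apply `ω` and take real parts
  apply_fun (fun M => (ω M).re) at hid
  -- the left-hand side
  have h12 : (1 / 2 : ℂ) = ((1 / 2 : ℝ) : ℂ) := by push_cast; ring
  have hlhs : (ω ((η : ℂ) • (1 : Matrix _ _ ℂ) - (1 / 2 : ℂ) •
      (localPair dWaveFormFactor L 0 + (localPair dWaveFormFactor L 0)ᴴ))).re =
      η - (ω (localPair dWaveFormFactor L 0)).re := by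
    rw [h12, map_sub, LinearMap.map_smul, LinearMap.map_smul, map_add, hω,
      groundStateFunctional_one hH, smul_eq_mul, smul_eq_mul, mul_one, Complex.sub_re,
      Complex.ofReal_re, Complex.re_ofReal_mul, Complex.add_re, groundStateFunctional_conjTranspose_re]
    ring
  -- the right-hand side, term by term
  have hsos : 0 ≤ (ω (cert.sos.map fun s => (s.toMatrix L)ᴴ * s.toMatrix L).sum).re :=
    re_map_list_sum_nonneg ω _ _ fun s _ => re_groundStateFunctional_sos_nonneg H _
  have hkkt : 0 ≤ (ω (cert.kkt.map fun a =>
      (a.toMatrix L)ᴴ * (H * a.toMatrix L - a.toMatrix L * H)).sum).re :=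
    re_map_list_sum_nonneg ω _ _ fun a _ => re_groundStateFunctional_kkt_nonneg hH _
  have hstat : (ω (cert.stat.map fun b => H * b.toMatrix L - b.toMatrix L * H).sum).re = 0 :=
    re_map_list_sum_eq_zero ω _ _ fun b _ => by
      rw [hω, groundStateFunctional_stat_eq_zero hH, Complex.zero_re]
  have hcob : (ω (cert.cob.map fun xB =>
      (xB.2.translate xB.1).toMatrix L - xB.2.toMatrix L).sum).re = 0 :=
    re_map_list_sum_eq_zero ω _ _ fun xB _ => by
      rw [map_sub, toMatrix_translate, hω, hHdef, groundStateFunctional_relabel_translate, sub_self,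
        Complex.zero_re]
  rw [hlhs, map_add, map_add, map_add, Complex.add_re, Complex.add_re, Complex.add_re, hstat, hcob]
    at hid
  rw [dWaveSourceDensity_eq_re_localPair]
  linarith


/-- **`OnePointSoundness`** (stmt-HubbardSuperconductivity-9685), by name: a one-point SOS certificate of
any level certifies the bound `dWaveSourceDensity L U μ h ≤ η` on every torus of side `L ≥ L₀`.
[cite: AraujoEtAl2023, §3.2 and §6.1] -/
theorem onePointSoundness_proof :
    Summit.HubbardSuperconductivity.HubbardSuperconductivity.Theses.AbsenceCertificate.OnePointSoundness :=
  fun R U μ h η hc => onePointSoundness_core R U μ h η hc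

end Summit.HubbardSuperconductivity.HubbardSuperconductivity.Theorems.AbsenceCertificate
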